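import Summits.CriticalPhenomena.PercolationContinuityZ3.Theorems.Transplant.FKConnectivityAllQPat3KNetSPSteps
import Summits.CriticalPhenomena.PercolationContinuityZ3.Theorems.Transplant.FKConnectivityAllQPat3KNetViewsPar
import Summits.CriticalPhenomena.PercolationContinuityZ3.Theorems.Transplant.FKConnectivityAllQPat3MinorRecursion
import HarnessLib

/-!
# Connectivity correlation inequalities for `φ_{w,q}`, every `q > 0` — THEOREM SP(𝒦), three inner marks (`pc`), the BRIDGE side: sub-cases

Helper file (`--supports stmt-CriticalPhenomena-4575`), census lineage (gen 41) of LANE 2's FK sub-programme; builds on p205010 (kernel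
theorem, internal audit signed; external expert review pending).  No definitions, no named facts, no sorries; standard axioms.

The `pc` step of THEOREM SP(𝒦)'s inner recursion (all three marks `b, s, t` inner in the side `E₁ = BRIDGE(Qac, Qad, Qbc, Qbd, Qcd; x, y)`,
the parallel part `E₂` mark-free; census g41 memo §6 (c), drafts/README).  The sub-cases one view («Pat3KNetViewsPar») away from a
finished statement: two corner marks ⇒ THEOREM 𝒯₂(𝒦) (`FK.pcK_bridge_two_corners`); a corner mark `c` or `d` and the other two in one slot
⇒ `pb` / type I at the view (`FK.pcK_bridge_cpb_ac / _cpb_cd`, `FK.pcK_bridge_dI_ac`); a corner mark and one mark in a slot through it ⇒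
CORNER (`FK.pcK_bridge_ccorner_ac / _cd`); three marks in one slot ⇒ the `pc` induction hypothesis (`FK.pcK_bridge_slot3_ac / _cd`); two in
one slot ⇒ type I (`FK.pcK_bridge_slot2_ac / _cd`).  The finished statements enter as hypotheses `hTypeI` (`FK.typeIK_good`), `hPb`
(`FK.pbK_good`), `ih`.  The position dispatch is «Pat3KNetSPBridgePcD».
[cite: AyyerLinussonRavichandran2025, §7 (p. 22)]
-/

namespace Summit.CriticalPhenomena.PercolationContinuityZ3.Theorems

namespace FK

open SimpleGraph Literature.Probability.LatticeModels Literature.Probability.Percolation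
open scoped Classical

variable {V : Type*}

section PcBridge

variable [Fintype V] {n : ℕ} {N₀ : Finset (Sym2 V)} {Qac Qad Qbc Qbd Qcd E₂ E C : Finset (Sym2 V)} {x y c d b s t m : V}

/-- **`pc`, bridge side, two corner marks**: in the view at `cd` both poles are marked — THEOREM 𝒯₂(𝒦). [cite: AyyerLinussonRavichandran2025, §7 (p. 22)] -/
theorem pcK_bridge_two_corners
    (hac : IsKNet Qac x c) (had : IsKNet Qad x d) (hbc : IsKNet Qbc y c) (hbd : IsKNet Qbd y d) (hcd : IsKNet Qcd c d)
    (hsep : BridgeSep Qac Qad Qbc Qbd Qcd x y c d) (h₂ : IsKNet E₂ x y) (hd : Disjoint (Qac ∪ Qad ∪ Qbc ∪ Qbd ∪ Qcd) E₂)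
    (hV : ∀ z : V, (∃ e ∈ Qac ∪ Qad ∪ Qbc ∪ Qbd ∪ Qcd, z ∈ e) → (∃ e ∈ E₂, z ∈ e) → z = x ∨ z = y)
    (hE : E ⊆ Qac ∪ Qad ∪ Qbc ∪ Qbd ∪ Qcd ∪ E₂) (hC : C ⊆ Qac ∪ Qad ∪ Qbc ∪ Qbd ∪ Qcd ∪ E₂)
    (hm : ∃ e ∈ Qac ∪ Qad ∪ Qbc ∪ Qbd ∪ Qcd ∪ E₂, m ∈ e) (hmc : m ≠ c) (hmd : m ≠ d) : SPGoodC E C c d m := by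
  obtain ⟨eN, hB, hdQ, hVQ⟩ := bridgePar_view_cd hac had hbc hbd hsep h₂ hd hV
  rw [eN] at hE hC hm
  exact spGoodC_inner_of_isKNet (IsKNet.parallel hcd hB hdQ hVQ) hE hC hm hmc hmd

omit [Fintype V] in
/-- **`pc`, bridge side, corner `c` marked and the other marks interior to `Qac`**: `pb` at the view through `c, x`. [cite: AyyerLinussonRavichandran2025, §7 (p. 22)] -/
theorem pcK_bridge_cpb_ac
    (hPb : ∀ {E₁ E₂ E C : Finset (Sym2 V)} {x y s t : V},
      IsKNet E₁ x y → IsKNet E₂ x y → Disjoint E₁ E₂ → E₁ ∪ E₂ ⊆ N₀ →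
      (∀ z : V, (∃ e ∈ E₁, z ∈ e) → (∃ e ∈ E₂, z ∈ e) → z = x ∨ z = y) →
      E ⊆ E₁ ∪ E₂ → C ⊆ E₁ ∪ E₂ →
      (∃ e ∈ E₁, s ∈ e) → (∃ e ∈ E₁, t ∈ e) →
      s ≠ x → s ≠ y → t ≠ x → t ≠ y → s ≠ t → SPGoodC E C x s t)
    (hac : IsKNet Qac x c) (had : IsKNet Qad x d) (hbc : IsKNet Qbc y c) (hbd : IsKNet Qbd y d) (hcd : IsKNet Qcd c d)
    (hsep : BridgeSep Qac Qad Qbc Qbd Qcd x y c d) (h₂ : IsKNet E₂ x y) (hd : Disjoint (Qac ∪ Qad ∪ Qbc ∪ Qbd ∪ Qcd) E₂) (hN : Qac ∪ Qad ∪ Qbc ∪ Qbd ∪ Qcd ∪ E₂ ⊆ N₀)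
    (hV : ∀ z : V, (∃ e ∈ Qac ∪ Qad ∪ Qbc ∪ Qbd ∪ Qcd, z ∈ e) → (∃ e ∈ E₂, z ∈ e) → z = x ∨ z = y)
    (hE : E ⊆ Qac ∪ Qad ∪ Qbc ∪ Qbd ∪ Qcd ∪ E₂) (hC : C ⊆ Qac ∪ Qad ∪ Qbc ∪ Qbd ∪ Qcd ∪ E₂)
    (hs : ∃ e ∈ Qac, s ∈ e) (ht : ∃ e ∈ Qac, t ∈ e) (hsx : s ≠ x) (hsc : s ≠ c) (htx : t ≠ x) (htc : t ≠ c) (hst : s ≠ t) :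
    SPGoodC E C c s t := by
  obtain ⟨eN, hB, hdQ, hVQ⟩ := bridgePar_view_ac hac had hbc hbd hcd hsep h₂ hd hV
  rw [eN] at hE hC hN
  exact hPb hac.symm hB.symm hdQ hN (fun z h1 h2 => (hVQ z h1 h2).symm) hE hC hs ht hsc hsx htc htx hst

omit [Fintype V] in
/-- **`pc`, bridge side, corner `c` marked and the other marks interior to `Qcd`**: `pb` at the view `cd`. [cite: AyyerLinussonRavichandran2025, §7 (p. 22)] -/
theorem pcK_bridge_cpb_cd
    (hPb : ∀ {E₁ E₂ E C : Finset (Sym2 V)} {x y s t : V},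
      IsKNet E₁ x y → IsKNet E₂ x y → Disjoint E₁ E₂ → E₁ ∪ E₂ ⊆ N₀ →
      (∀ z : V, (∃ e ∈ E₁, z ∈ e) → (∃ e ∈ E₂, z ∈ e) → z = x ∨ z = y) →
      E ⊆ E₁ ∪ E₂ → C ⊆ E₁ ∪ E₂ →
      (∃ e ∈ E₁, s ∈ e) → (∃ e ∈ E₁, t ∈ e) →
      s ≠ x → s ≠ y → t ≠ x → t ≠ y → s ≠ t → SPGoodC E C x s t)
    (hac : IsKNet Qac x c) (had : IsKNet Qad x d) (hbc : IsKNet Qbc y c) (hbd : IsKNet Qbd y d) (hcd : IsKNet Qcd c d)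
    (hsep : BridgeSep Qac Qad Qbc Qbd Qcd x y c d) (h₂ : IsKNet E₂ x y) (hd : Disjoint (Qac ∪ Qad ∪ Qbc ∪ Qbd ∪ Qcd) E₂) (hN : Qac ∪ Qad ∪ Qbc ∪ Qbd ∪ Qcd ∪ E₂ ⊆ N₀)
    (hV : ∀ z : V, (∃ e ∈ Qac ∪ Qad ∪ Qbc ∪ Qbd ∪ Qcd, z ∈ e) → (∃ e ∈ E₂, z ∈ e) → z = x ∨ z = y)
    (hE : E ⊆ Qac ∪ Qad ∪ Qbc ∪ Qbd ∪ Qcd ∪ E₂) (hC : C ⊆ Qac ∪ Qad ∪ Qbc ∪ Qbd ∪ Qcd ∪ E₂)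
    (hs : ∃ e ∈ Qcd, s ∈ e) (ht : ∃ e ∈ Qcd, t ∈ e) (hsc : s ≠ c) (hsd : s ≠ d) (htc : t ≠ c) (htd : t ≠ d) (hst : s ≠ t) :
    SPGoodC E C c s t := by
  obtain ⟨eN, hB, hdQ, hVQ⟩ := bridgePar_view_cd hac had hbc hbd hsep h₂ hd hV
  rw [eN] at hE hC hN
  exact hPb hcd hB hdQ hN hVQ hE hC hs ht hsc hsd htc htd hst

omit [Fintype V] in
/-- **`pc`, bridge side, corner `d` marked and the other marks interior to `Qac`**: type I at the view `ac` (`d` inner in the completed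
bridge). [cite: AyyerLinussonRavichandran2025, §7 (p. 22)] -/
theorem pcK_bridge_dI_ac
    (hTypeI : ∀ {E₁ E₂ E C : Finset (Sym2 V)} {x y b s t : V},
      IsKNet E₁ x y → IsKNet E₂ x y → Disjoint E₁ E₂ → E₁ ∪ E₂ ⊆ N₀ →
      (∀ z : V, (∃ e ∈ E₁, z ∈ e) → (∃ e ∈ E₂, z ∈ e) → z = x ∨ z = y) →
      E ⊆ E₁ ∪ E₂ → C ⊆ E₁ ∪ E₂ →
      (∃ e ∈ E₁, s ∈ e) → (∃ e ∈ E₁, t ∈ e) → (∃ e ∈ E₂, b ∈ e) →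
      s ≠ x → s ≠ y → t ≠ x → t ≠ y → b ≠ x → b ≠ y → s ≠ t → SPGoodC E C b s t)
    (hac : IsKNet Qac x c) (had : IsKNet Qad x d) (hbc : IsKNet Qbc y c) (hbd : IsKNet Qbd y d) (hcd : IsKNet Qcd c d)
    (hsep : BridgeSep Qac Qad Qbc Qbd Qcd x y c d) (h₂ : IsKNet E₂ x y) (hd : Disjoint (Qac ∪ Qad ∪ Qbc ∪ Qbd ∪ Qcd) E₂) (hN : Qac ∪ Qad ∪ Qbc ∪ Qbd ∪ Qcd ∪ E₂ ⊆ N₀)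
    (hV : ∀ z : V, (∃ e ∈ Qac ∪ Qad ∪ Qbc ∪ Qbd ∪ Qcd, z ∈ e) → (∃ e ∈ E₂, z ∈ e) → z = x ∨ z = y)
    (hE : E ⊆ Qac ∪ Qad ∪ Qbc ∪ Qbd ∪ Qcd ∪ E₂) (hC : C ⊆ Qac ∪ Qad ∪ Qbc ∪ Qbd ∪ Qcd ∪ E₂)
    (hs : ∃ e ∈ Qac, s ∈ e) (ht : ∃ e ∈ Qac, t ∈ e) (hsx : s ≠ x) (hsc : s ≠ c) (htx : t ≠ x) (htc : t ≠ c) (hst : s ≠ t) :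
    SPGoodC E C d s t := by
  obtain ⟨eN, hB, hdQ, hVQ⟩ := bridgePar_view_ac hac had hbc hbd hcd hsep h₂ hd hV
  rw [eN] at hE hC hN
  obtain ⟨f, hf, hdf⟩ := had.right_mem
  have hdc : d ≠ c := fun h => hcd.ne h.symm
  exact hTypeI hac hB hdQ hN hVQ hE hC hs ht ⟨f, Finset.mem_union_left _ (Finset.mem_union_left _ (Finset.mem_union_left _
    (Finset.mem_union_right _ hf))), hdf⟩ hsx hsc htx htc had.ne.symm hdc hst

/-- **`pc`, bridge side, corner `c` marked, one mark interior to `Qac`, the third off `Qac`**: CORNER at the view through `c, x`.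
[cite: AyyerLinussonRavichandran2025, §7 (p. 22)] -/
theorem pcK_bridge_ccorner_ac
    (hac : IsKNet Qac x c) (had : IsKNet Qad x d) (hbc : IsKNet Qbc y c) (hbd : IsKNet Qbd y d) (hcd : IsKNet Qcd c d)
    (hsep : BridgeSep Qac Qad Qbc Qbd Qcd x y c d) (h₂ : IsKNet E₂ x y) (hd : Disjoint (Qac ∪ Qad ∪ Qbc ∪ Qbd ∪ Qcd) E₂)
    (hV : ∀ z : V, (∃ e ∈ Qac ∪ Qad ∪ Qbc ∪ Qbd ∪ Qcd, z ∈ e) → (∃ e ∈ E₂, z ∈ e) → z = x ∨ z = y)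
    (hE : E ⊆ Qac ∪ Qad ∪ Qbc ∪ Qbd ∪ Qcd ∪ E₂) (hC : C ⊆ Qac ∪ Qad ∪ Qbc ∪ Qbd ∪ Qcd ∪ E₂)
    (hs : ∃ e ∈ Qac, s ∈ e) (hsx : s ≠ x) (hsc : s ≠ c)
    (ht : ∃ e ∈ E₂ ∪ Qad ∪ Qbc ∪ Qcd ∪ Qbd, t ∈ e) (htx : t ≠ x) (htc : t ≠ c) : SPGoodC E C c s t := by
  obtain ⟨eN, hB, hdQ, hVQ⟩ := bridgePar_view_ac hac had hbc hbd hcd hsep h₂ hd hV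
  rw [eN] at hE hC
  have hc := spGoodC_cornerK hdQ (fun z h1 h2 => (hVQ z h1 h2).symm) hac.symm hB.symm (Finset.inter_subset_right (s₁ := E))
    (Finset.inter_subset_right (s₁ := C)) (Finset.inter_subset_right (s₁ := E)) (Finset.inter_subset_right (s₁ := C)) hs ht hsc hsx
    htc htx
  exact hc.congr_sets (inter_union2_eq hE rfl) (inter_union2_eq hC rfl)

/-- **`pc`, bridge side, corner `c` marked, one mark interior to `Qcd`, the third off `Qcd`**: CORNER at the view `cd`.
[cite: AyyerLinussonRavichandran2025, §7 (p. 22)] -/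
theorem pcK_bridge_ccorner_cd
    (hac : IsKNet Qac x c) (had : IsKNet Qad x d) (hbc : IsKNet Qbc y c) (hbd : IsKNet Qbd y d) (hcd : IsKNet Qcd c d)
    (hsep : BridgeSep Qac Qad Qbc Qbd Qcd x y c d) (h₂ : IsKNet E₂ x y) (hd : Disjoint (Qac ∪ Qad ∪ Qbc ∪ Qbd ∪ Qcd) E₂)
    (hV : ∀ z : V, (∃ e ∈ Qac ∪ Qad ∪ Qbc ∪ Qbd ∪ Qcd, z ∈ e) → (∃ e ∈ E₂, z ∈ e) → z = x ∨ z = y)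
    (hE : E ⊆ Qac ∪ Qad ∪ Qbc ∪ Qbd ∪ Qcd ∪ E₂) (hC : C ⊆ Qac ∪ Qad ∪ Qbc ∪ Qbd ∪ Qcd ∪ E₂)
    (hs : ∃ e ∈ Qcd, s ∈ e) (hsc : s ≠ c) (hsd : s ≠ d)
    (ht : ∃ e ∈ Qac ∪ Qbc ∪ Qad ∪ Qbd ∪ E₂, t ∈ e) (htc : t ≠ c) (htd : t ≠ d) : SPGoodC E C c s t := by
  obtain ⟨eN, hB, hdQ, hVQ⟩ := bridgePar_view_cd hac had hbc hbd hsep h₂ hd hV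
  rw [eN] at hE hC
  have hc := spGoodC_cornerK hdQ hVQ hcd hB (Finset.inter_subset_right (s₁ := E)) (Finset.inter_subset_right (s₁ := C))
    (Finset.inter_subset_right (s₁ := E)) (Finset.inter_subset_right (s₁ := C)) hs ht hsc hsd htc htd
  exact hc.congr_sets (inter_union2_eq hE rfl) (inter_union2_eq hC rfl)

omit [Fintype V] in
/-- **`pc`, bridge side, the three marks interior to `Qac`**: the `pc` induction hypothesis at the view `ac`. [cite: AyyerLinussonRavichandran2025, §7 (p. 22)] -/
theorem pcK_bridge_slot3_ac
    (ih : ∀ {E₁ E₂ E C : Finset (Sym2 V)} {x y b s t : V}, E₁.card ≤ n →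
      IsKNet E₁ x y → IsKNet E₂ x y → Disjoint E₁ E₂ → E₁ ∪ E₂ ⊆ N₀ →
      (∀ z : V, (∃ e ∈ E₁, z ∈ e) → (∃ e ∈ E₂, z ∈ e) → z = x ∨ z = y) →
      E ⊆ E₁ ∪ E₂ → C ⊆ E₁ ∪ E₂ →
      (∃ e ∈ E₁, b ∈ e) → (∃ e ∈ E₁, s ∈ e) → (∃ e ∈ E₁, t ∈ e) →
      b ≠ x → b ≠ y → s ≠ x → s ≠ y → t ≠ x → t ≠ y → b ≠ s → b ≠ t → s ≠ t → SPGoodC E C b s t)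
    (hac : IsKNet Qac x c) (had : IsKNet Qad x d) (hbc : IsKNet Qbc y c) (hbd : IsKNet Qbd y d) (hcd : IsKNet Qcd c d)
    (hsep : BridgeSep Qac Qad Qbc Qbd Qcd x y c d) (h₂ : IsKNet E₂ x y) (hd : Disjoint (Qac ∪ Qad ∪ Qbc ∪ Qbd ∪ Qcd) E₂) (hN : Qac ∪ Qad ∪ Qbc ∪ Qbd ∪ Qcd ∪ E₂ ⊆ N₀)
    (hV : ∀ z : V, (∃ e ∈ Qac ∪ Qad ∪ Qbc ∪ Qbd ∪ Qcd, z ∈ e) → (∃ e ∈ E₂, z ∈ e) → z = x ∨ z = y)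
    (hE : E ⊆ Qac ∪ Qad ∪ Qbc ∪ Qbd ∪ Qcd ∪ E₂) (hC : C ⊆ Qac ∪ Qad ∪ Qbc ∪ Qbd ∪ Qcd ∪ E₂) (hcard : (Qac ∪ Qad ∪ Qbc ∪ Qbd ∪ Qcd).card ≤ n + 1)
    (hb : ∃ e ∈ Qac, b ∈ e) (hs : ∃ e ∈ Qac, s ∈ e) (ht : ∃ e ∈ Qac, t ∈ e)
    (hbx : b ≠ x) (hbc' : b ≠ c) (hsx : s ≠ x) (hsc : s ≠ c) (htx : t ≠ x) (htc : t ≠ c) (hbs : b ≠ s) (hbt : b ≠ t) (hst : s ≠ t) :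
    SPGoodC E C b s t := by
  obtain ⟨eN, hB, hdQ, hVQ⟩ := bridgePar_view_ac hac had hbc hbd hcd hsep h₂ hd hV
  have hlt := card_ac_lt_bridge hcd hsep
  rw [eN] at hE hC hN
  exact ih (by omega) hac hB hdQ hN hVQ hE hC hb hs ht hbx hbc' hsx hsc htx htc hbs hbt hst

omit [Fintype V] in
/-- **`pc`, bridge side, the three marks interior to `Qcd`**: the `pc` induction hypothesis at the view `cd`. [cite: AyyerLinussonRavichandran2025, §7 (p. 22)] -/
theorem pcK_bridge_slot3_cd
    (ih : ∀ {E₁ E₂ E C : Finset (Sym2 V)} {x y b s t : V}, E₁.card ≤ n →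
      IsKNet E₁ x y → IsKNet E₂ x y → Disjoint E₁ E₂ → E₁ ∪ E₂ ⊆ N₀ →
      (∀ z : V, (∃ e ∈ E₁, z ∈ e) → (∃ e ∈ E₂, z ∈ e) → z = x ∨ z = y) →
      E ⊆ E₁ ∪ E₂ → C ⊆ E₁ ∪ E₂ →
      (∃ e ∈ E₁, b ∈ e) → (∃ e ∈ E₁, s ∈ e) → (∃ e ∈ E₁, t ∈ e) →
      b ≠ x → b ≠ y → s ≠ x → s ≠ y → t ≠ x → t ≠ y → b ≠ s → b ≠ t → s ≠ t → SPGoodC E C b s t)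
    (hac : IsKNet Qac x c) (had : IsKNet Qad x d) (hbc : IsKNet Qbc y c) (hbd : IsKNet Qbd y d) (hcd : IsKNet Qcd c d)
    (hsep : BridgeSep Qac Qad Qbc Qbd Qcd x y c d) (h₂ : IsKNet E₂ x y) (hd : Disjoint (Qac ∪ Qad ∪ Qbc ∪ Qbd ∪ Qcd) E₂) (hN : Qac ∪ Qad ∪ Qbc ∪ Qbd ∪ Qcd ∪ E₂ ⊆ N₀)
    (hV : ∀ z : V, (∃ e ∈ Qac ∪ Qad ∪ Qbc ∪ Qbd ∪ Qcd, z ∈ e) → (∃ e ∈ E₂, z ∈ e) → z = x ∨ z = y)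
    (hE : E ⊆ Qac ∪ Qad ∪ Qbc ∪ Qbd ∪ Qcd ∪ E₂) (hC : C ⊆ Qac ∪ Qad ∪ Qbc ∪ Qbd ∪ Qcd ∪ E₂) (hcard : (Qac ∪ Qad ∪ Qbc ∪ Qbd ∪ Qcd).card ≤ n + 1)
    (hb : ∃ e ∈ Qcd, b ∈ e) (hs : ∃ e ∈ Qcd, s ∈ e) (ht : ∃ e ∈ Qcd, t ∈ e)
    (hbc' : b ≠ c) (hbd' : b ≠ d) (hsc : s ≠ c) (hsd : s ≠ d) (htc : t ≠ c) (htd : t ≠ d) (hbs : b ≠ s) (hbt : b ≠ t) (hst : s ≠ t) :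
    SPGoodC E C b s t := by
  obtain ⟨eN, hB, hdQ, hVQ⟩ := bridgePar_view_cd hac had hbc hbd hsep h₂ hd hV
  have hlt := card_cd_lt_bridge hac hsep
  rw [eN] at hE hC hN
  exact ih (by omega) hcd hB hdQ hN hVQ hE hC hb hs ht hbc' hbd' hsc hsd htc htd hbs hbt hst

omit [Fintype V] in
/-- **`pc`, bridge side, two marks interior to `Qac`, the third off `Qac`**: type I at the view `ac`. [cite: AyyerLinussonRavichandran2025, §7 (p. 22)] -/
theorem pcK_bridge_slot2_ac
    (hTypeI : ∀ {E₁ E₂ E C : Finset (Sym2 V)} {x y b s t : V},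
      IsKNet E₁ x y → IsKNet E₂ x y → Disjoint E₁ E₂ → E₁ ∪ E₂ ⊆ N₀ →
      (∀ z : V, (∃ e ∈ E₁, z ∈ e) → (∃ e ∈ E₂, z ∈ e) → z = x ∨ z = y) →
      E ⊆ E₁ ∪ E₂ → C ⊆ E₁ ∪ E₂ →
      (∃ e ∈ E₁, s ∈ e) → (∃ e ∈ E₁, t ∈ e) → (∃ e ∈ E₂, b ∈ e) →
      s ≠ x → s ≠ y → t ≠ x → t ≠ y → b ≠ x → b ≠ y → s ≠ t → SPGoodC E C b s t)
    (hac : IsKNet Qac x c) (had : IsKNet Qad x d) (hbc : IsKNet Qbc y c) (hbd : IsKNet Qbd y d) (hcd : IsKNet Qcd c d)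
    (hsep : BridgeSep Qac Qad Qbc Qbd Qcd x y c d) (h₂ : IsKNet E₂ x y) (hd : Disjoint (Qac ∪ Qad ∪ Qbc ∪ Qbd ∪ Qcd) E₂) (hN : Qac ∪ Qad ∪ Qbc ∪ Qbd ∪ Qcd ∪ E₂ ⊆ N₀)
    (hV : ∀ z : V, (∃ e ∈ Qac ∪ Qad ∪ Qbc ∪ Qbd ∪ Qcd, z ∈ e) → (∃ e ∈ E₂, z ∈ e) → z = x ∨ z = y)
    (hE : E ⊆ Qac ∪ Qad ∪ Qbc ∪ Qbd ∪ Qcd ∪ E₂) (hC : C ⊆ Qac ∪ Qad ∪ Qbc ∪ Qbd ∪ Qcd ∪ E₂)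
    (hs : ∃ e ∈ Qac, s ∈ e) (ht : ∃ e ∈ Qac, t ∈ e) (hb : ∃ e ∈ E₂ ∪ Qad ∪ Qbc ∪ Qcd ∪ Qbd, b ∈ e)
    (hsx : s ≠ x) (hsc : s ≠ c) (htx : t ≠ x) (htc : t ≠ c) (hbx : b ≠ x) (hbc' : b ≠ c) (hst : s ≠ t) : SPGoodC E C b s t := by
  obtain ⟨eN, hB, hdQ, hVQ⟩ := bridgePar_view_ac hac had hbc hbd hcd hsep h₂ hd hV
  rw [eN] at hE hC hN
  exact hTypeI hac hB hdQ hN hVQ hE hC hs ht hb hsx hsc htx htc hbx hbc' hst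

omit [Fintype V] in
/-- **`pc`, bridge side, two marks interior to `Qcd`, the third off `Qcd`**: type I at the view `cd`. [cite: AyyerLinussonRavichandran2025, §7 (p. 22)] -/
theorem pcK_bridge_slot2_cd
    (hTypeI : ∀ {E₁ E₂ E C : Finset (Sym2 V)} {x y b s t : V},
      IsKNet E₁ x y → IsKNet E₂ x y → Disjoint E₁ E₂ → E₁ ∪ E₂ ⊆ N₀ →
      (∀ z : V, (∃ e ∈ E₁, z ∈ e) → (∃ e ∈ E₂, z ∈ e) → z = x ∨ z = y) →
      E ⊆ E₁ ∪ E₂ → C ⊆ E₁ ∪ E₂ →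
      (∃ e ∈ E₁, s ∈ e) → (∃ e ∈ E₁, t ∈ e) → (∃ e ∈ E₂, b ∈ e) →
      s ≠ x → s ≠ y → t ≠ x → t ≠ y → b ≠ x → b ≠ y → s ≠ t → SPGoodC E C b s t)
    (hac : IsKNet Qac x c) (had : IsKNet Qad x d) (hbc : IsKNet Qbc y c) (hbd : IsKNet Qbd y d) (hcd : IsKNet Qcd c d)
    (hsep : BridgeSep Qac Qad Qbc Qbd Qcd x y c d) (h₂ : IsKNet E₂ x y) (hd : Disjoint (Qac ∪ Qad ∪ Qbc ∪ Qbd ∪ Qcd) E₂) (hN : Qac ∪ Qad ∪ Qbc ∪ Qbd ∪ Qcd ∪ E₂ ⊆ N₀)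
    (hV : ∀ z : V, (∃ e ∈ Qac ∪ Qad ∪ Qbc ∪ Qbd ∪ Qcd, z ∈ e) → (∃ e ∈ E₂, z ∈ e) → z = x ∨ z = y)
    (hE : E ⊆ Qac ∪ Qad ∪ Qbc ∪ Qbd ∪ Qcd ∪ E₂) (hC : C ⊆ Qac ∪ Qad ∪ Qbc ∪ Qbd ∪ Qcd ∪ E₂)
    (hs : ∃ e ∈ Qcd, s ∈ e) (ht : ∃ e ∈ Qcd, t ∈ e) (hb : ∃ e ∈ Qac ∪ Qbc ∪ Qad ∪ Qbd ∪ E₂, b ∈ e)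
    (hsc : s ≠ c) (hsd : s ≠ d) (htc : t ≠ c) (htd : t ≠ d) (hbc' : b ≠ c) (hbd' : b ≠ d) (hst : s ≠ t) : SPGoodC E C b s t := by
  obtain ⟨eN, hB, hdQ, hVQ⟩ := bridgePar_view_cd hac had hbc hbd hsep h₂ hd hV
  rw [eN] at hE hC hN
  exact hTypeI hcd hB hdQ hN hVQ hE hC hs ht hb hsc hsd htc htd hbc' hbd' hst

end PcBridge

end FK

end Summit.CriticalPhenomena.PercolationContinuityZ3.Theorems
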